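import Summits.BirchSwinnertonDyer.BirchSwinnertonDyer.Theorems.ErratumRoadFiveIMCDivRoadFFFittingCutB
import HarnessLib

/-!
# Route `ErratumRoadFive` (rung K2, `p ≥ 5`), crux `IMCDivAtErratumDataAll` (item stmt-BirchSwinnertonDyer-19270) →
# `IMCDivAtErratumDataAllR`: the PACKAGE OF RECORD (imc24b's one-sided-(c) congruence data) in TWO-PRIME form
# `(𝔭L, 𝔭X)` — plan g30 RULING 4's rule of record —, its glue to the B-atom, and its feed into the two-stub cut

Cell `bsd-stepL` (run/shared/lean/pub/bsd-stepL/), seat `bsd-stepL-imc-p1` (prover g9, 2026-08-27); `--supports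
stmt-BirchSwinnertonDyer-19270 --as helper`; Theses-free (imports only this seat's `ErratumRoadFiveIMCDivRoadFFFittingCutB`,
p495387, and through it imc24b's `…OneSidedCongruenceLeDefs`, imc24c's `…OneSidedCongruenceDefs` and the atoms B).

CREDIT. §1's definition `P2.OneSidedCongruenceDataLeAt₂`, the diagonal `Iff.rfl`, the theorem
`P2.exists_unrFrame_charIdeal_map_le_of_oneSidedCongruenceDataLeAt₂` and the wrapper
`P2.OneSidedCongruenceDataLeAtErratumDataB` are the four declarations ELABORATED by the independent orientation auditor
(refuter seat `bsd-stepL-orient-a1` g0, `HOME/audit/orient-a1/OrientB2.lean`, sha16 e372eaebeaabf9de, 2026-08-27T03:59:39Z,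
correction (N1); booked as rule of record by plan g30 RULING 4, 04:11:37Z; refereed VERDICT-ORIENTA1-g39). A refuter seat
cannot write under `Theorems/`; this prover lands them VERBATIM (names, binders, bodies) and adds the glue (§2) and the feed
into the coefficient-free two-stub cut (§3).

WHY TWO PRIMES (N1, and this seat's identical finding 04:11:47Z). The one-sided-(c) package
`P2.OneSidedCongruenceDataLeAt W p κ 𝔭 γ ι f` feeds ONE prime `𝔭` to BOTH the frame's interpolation MULTIPLIER
(`IsBDPLFunction ι 𝔭 …`, `bdpInterpolationValue p f 𝔭 φ n Ω_K`) AND the X-slot `XAc (W.baseChange K) p κ 𝔭 S γ`. After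
the orientation repair (form (a)) the crux pairs the frame at `𝔭L := 𝔭_{ι'}` with the Selmer dual strict at `𝔭X := 𝔭bar`;
the diagonal package at `𝔭 := 𝔭bar` would carry the MIXED frame `IsBDPLFunction ι' 𝔭bar` (no printed object; unsatisfiable on
paper at rank-one data). Hence: frame + `L`-side conjuncts at `𝔭L`, every `XAc` ∕ `N_m` conjunct at `𝔭X`; the §1 algebra
(`AcSelmer.XAc.charIdeal_map_toUnr_le_span_of_oneSided_congruences_le`, imc24b p482171) is frame-blind, so every proof is
the tree's term with `𝔭X` in the X-slot.

## Contents (namespace `Summit.BirchSwinnertonDyer.Rank1Residual.X11b`)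

* §1 `P2.OneSidedCongruenceDataLeAt₂ W p κ 𝔭L 𝔭X γ ι f` (`@[conjecture]` shape), `…_self_iff` (diagonal = imc24b's package,
  `Iff.rfl`), `P2.exists_unrFrame_charIdeal_map_le_of_oneSidedCongruenceDataLeAt₂`, `P2.exists_intCoreFrame_of_
  oneSidedCongruenceDataLeAt₂` (∘ the two-slot last mile ⟹ EXACTLY the B-atom's datum conclusion at `(𝔭_{ι'}, 𝔭bar)`).
* §2 wrapper `P2.OneSidedCongruenceDataLeAtErratumDataB W p` and glue **`P2.imcDivIntCoreFrameAtErratumDataB_of_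
  oneSidedCongruenceDataLeAtErratumDataB`** (the package of record at every erratum datum, two-prime ⟹ the repaired crux's
  shape `P2.IMCDivIntCoreFrameAtErratumDataB W p`).
* §3 feed into the two-stub cut: `P2.RoadFF.exists_sigmaDataAt_fittingCongruenceFrameTwoSlotAt_of_oneSidedCongruenceDataLeAt₂`
  — the two-prime package yields `Σ`-data at `𝔭X` AND the two-slot Fitting-level frame at `(𝔭L, 𝔭X)` for its own `(Σ, P_Σ)`
  (the `Λ`-members are members over the trivial coefficient square; p490889's `fittingCongruenceFrameAt_of_roadFF` at two slots).

HONEST FRAMING: two definitions with bodies (open shapes; nothing asserted) and regrouping theorems; no named fact, no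
instance, no notation, no `sorry`; nothing is booked; BSD is proved for no pair; the anticyclotomic main conjecture is asserted
nowhere. References: [Castella2018Erratum] (a)–(c), Lemmas 2.1–2.2, (2.4)–(2.5), proof of Thm. 1.1 (pp. 2–4); [Castella2018]
Def. 2.2, (3.1), Thm. 3.1 (arXiv:1704.06608 pp. 5, 9, 11); [FouquetWan2021] Thm. 4.41 (PREPRINT; shape only);
[CastellaGrossiLeeSkinner2022] §2 (the `(v, v̄)` slotting); HOME/audit/ORIENT-AUDIT-19270-orient-a1.md (N1);
HOME/audit/ORIENT-AUDIT-19270-imc-p1-g8.md Q4 (a).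
-/

set_option autoImplicit false

noncomputable section

open scoped Classical TensorProduct

open WeierstrassCurve NumberField IsDedekindDomain Field PowerSeries
open Literature.NumberTheory.EllipticCurves Literature.NumberTheory.EllipticCurves.GreenbergSelmer
  Literature.NumberTheory.EllipticCurves.ModularForms Literature.NumberTheory.EllipticCurves.Rank1Residual
  Literature.NumberTheory.EllipticCurves.Rank1Residual.Typed Literature.NumberTheory.EllipticCurves.Castella2018
  Literature.NumberTheory.EllipticCurves.Module Literature.NumberTheory.GaloisRepresentations
  Literature.NumberTheory.GaloisCohomology Literature.RingTheory.FittingIdeal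
open Summit.BirchSwinnertonDyer.Rank1Residual.X11b.AcSelmer Summit.BirchSwinnertonDyer.Rank1Residual.X11b.Halves
  Summit.BirchSwinnertonDyer.Rank1Residual.X2

namespace Summit.BirchSwinnertonDyer.Rank1Residual.X11b

/-! ### §1 The package of record with the frame prime and the X-slot prime separated (orient-a1's text) -/

section TwoPrimes

variable {K : Type} [Field K] [NumberField K] (W : WeierstrassCurve ℚ) (p : ℕ) [Fact p.Prime]
  (κ : ZpExtension K p) (𝔭L 𝔭X : HeightOneSpectrum (𝓞 K)) (γ : Field.absoluteGaloisGroup K)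
  [Fact (κ.IsTopGenerator γ)] (ι : PadicAlgCl p ≃+* ℂ) {N : ℕ}
  (f : CuspForm (CongruenceSubgroup.Gamma0 N) 2)

/-- **ONE-SIDED CONGRUENCE DATA AT A DATUM, TWO PRIMES (shape; asserts nothing)** — the body of imc24b's
`P2.OneSidedCongruenceDataLeAt W p κ 𝔭 γ ι f` VERBATIM with the frame's interpolation prime `𝔭L` (`IsBDPLFunction ι 𝔭L …`,
the multiplier `(1 − a_p p⁻¹ φ(𝔭L))²` [Cas18 Thm. 3.1]) SEPARATED from the X-slot prime `𝔭X` of every Selmer-dual conjunct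
(`XAc (W.baseChange K) p κ 𝔭X S γ`: torsion [CTL], one-sided `Σ`-removal `Ch(X^∅)·(P_Σ) ⊆ Ch(X^Σ)`, members `N_m` with
`X^Σ/p^m ≅ N_m/p^m` [(b) + Lemma 2.1], `N_m` torsion → `Ch_Λ(N_m)·R₀⟦T⟧ ⊆ (L_m)` [(2.5)_m = FW21 Thm. 4.41, PREPRINT],
`(L_m) ⊆ (L^Σ) + (p^m)` [(c)]). The repaired crux uses `𝔭L = 𝔭_{ι'}`, `𝔭X = 𝔭bar`; the diagonal `𝔭L = 𝔭X` is the old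
package. Declared first by orient-a1 (`OrientB2.lean`); landed verbatim. A predicate; NEVER a theorem in this cell.
[claim: Castella2018Erratum, status: under-review]
[cite: Castella2018Erratum, (a)–(c), Lemmas 2.1–2.2, (2.5), proof of Thm. 1.1 (pp. 2–4) (shape only; nothing asserted)]
[cite: Castella2018, Def. 2.2, (3.1), Thm. 3.1 (arXiv:1704.06608 pp. 5, 9, 11) (shape only; nothing asserted)]
[cite: CastellaGrossiLeeSkinner2022, §2 (the `(v, v̄)` slotting; shape only)] -/
@[conjecture]
def P2.OneSidedCongruenceDataLeAt₂ : Prop :=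
  ∃ (ΩK : ℂ) (Ωp : (unrIntegers p)ˣ) (L : UnrSeries p) (S : Set (HeightOneSpectrum (𝓞 K)))
    (PS : IwasawaAlgebra p) (LS : UnrSeries p) (Nm : ℕ → ModuleCat.{0} (IwasawaAlgebra p))
    (Lm : ℕ → UnrSeries p),
    ΩK ≠ 0 ∧ IsBDPLFunction ι 𝔭L κ γ f ΩK ((Ωp : unrIntegers p) : ℂ_[p]) L ∧
    S.Finite ∧ Module.IsTorsion (IwasawaAlgebra p) (XAc (W.baseChange K) p κ 𝔭X S γ) ∧
    PS ≠ 0 ∧ XAc.charIdeal (W.baseChange K) p κ 𝔭X ∅ γ * Ideal.span {PS} ≤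
      XAc.charIdeal (W.baseChange K) p κ 𝔭X S γ ∧
    L * PowerSeries.map (toUnr p) PS ∣ LS ∧
    (∀ m : ℕ, Module.Finite (IwasawaAlgebra p) (Nm m)) ∧
    (∀ m : ℕ, 1 ≤ m → Nonempty
      ((XAc (W.baseChange K) p κ 𝔭X S γ ⧸
          ((Ideal.span {(PowerSeries.C (p : ℤ_[p]) : IwasawaAlgebra p)}) ^ m •
            (⊤ : Submodule (IwasawaAlgebra p) (XAc (W.baseChange K) p κ 𝔭X S γ)))) ≃ₗ[IwasawaAlgebra p]
        ((Nm m) ⧸ ((Ideal.span {(PowerSeries.C (p : ℤ_[p]) : IwasawaAlgebra p)}) ^ m •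
          (⊤ : Submodule (IwasawaAlgebra p) (Nm m)))))) ∧
    (∀ m : ℕ, 1 ≤ m → Module.IsTorsion (IwasawaAlgebra p) (Nm m) →
      (Module.charIdeal (IwasawaAlgebra p) (Nm m)).map (PowerSeries.map (toUnr p)) ≤ Ideal.span {Lm m}) ∧
    (∀ m : ℕ, 1 ≤ m →
      Ideal.span {Lm m} ≤
        Ideal.span {LS} ⊔ (Ideal.span {(PowerSeries.C ((p : ℕ) : unrIntegers p) : UnrSeries p)}) ^ m)

/-- On the diagonal `𝔭L = 𝔭X` the two-prime package IS imc24b's package of record (`Iff.rfl`; orient-a1's check).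
[folklore] -/
theorem P2.oneSidedCongruenceDataLeAt₂_self_iff :
    P2.OneSidedCongruenceDataLeAt₂ W p κ 𝔭X 𝔭X γ ι f ↔ P2.OneSidedCongruenceDataLeAt W p κ 𝔭X γ ι f :=
  Iff.rfl

variable {W p κ 𝔭L 𝔭X γ ι f}

/-- **The §1 algebra is X-slot-generic and frame-blind** (orient-a1's theorem, landed verbatim): the two-prime package gives
an `R₀`-frame AT `𝔭L` with `Ch_Λ(XAc … 𝔭X ∅ γ)·R₀⟦T⟧ ⊆ (L)`, by imc24b's
`AcSelmer.XAc.charIdeal_map_toUnr_le_span_of_oneSided_congruences_le` at the slot `𝔭X`. Unconditional in the package.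
[cite: Castella2018Erratum, proof of Thm. 1.1 (p. 4), read one-sidedly] -/
theorem P2.exists_unrFrame_charIdeal_map_le_of_oneSidedCongruenceDataLeAt₂ [W.IsElliptic]
    (h : P2.OneSidedCongruenceDataLeAt₂ W p κ 𝔭L 𝔭X γ ι f) :
    ∃ (ΩK : ℂ) (Ωp : (unrIntegers p)ˣ) (L : UnrSeries p), ΩK ≠ 0 ∧
      IsBDPLFunction ι 𝔭L κ γ f ΩK ((Ωp : unrIntegers p) : ℂ_[p]) L ∧
      (XAc.charIdeal (W.baseChange K) p κ 𝔭X ∅ γ).map (PowerSeries.map (toUnr p)) ≤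
        Ideal.span {L} := by
  obtain ⟨ΩK, Ωp, L, S, PS, LS, Nm, Lm, hΩ, hL, hS, hT, hPS, hX, hLS, hfin, he, hF, hc⟩ := h
  haveI : ∀ m, Module.Finite (IwasawaAlgebra p) (Nm m) := hfin
  exact ⟨ΩK, Ωp, L, hΩ, hL,
    AcSelmer.XAc.charIdeal_map_toUnr_le_span_of_oneSided_congruences_le (W.baseChange K) p κ 𝔭X γ hS
      hT (fun m ↦ Nm m) LS Lm (fun m hm ↦ (he m hm).some) hF hc hPS hX hLS⟩

/-- **At a datum: the two-prime package ⟹ a ♭-frame AT `𝔭L` with the divisibility for `XAc … 𝔭X ∅ γ`** (∘ this seat's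
two-slot last mile `P2.exists_intCoreFrame_of_unrFrame_of_charIdeal_map_le_twoSlot`) — for `𝔭L := 𝔭_{ι'}`, `𝔭X := 𝔭bar`
EXACTLY the datum conclusion of `P2.IMCDivIntCoreFrameAtErratumDataB`. Unconditional in the package; closes nothing.
[cite: Castella2018Erratum, (2.4) and proof of Thm. 1.1 (p. 4)] -/
theorem P2.exists_intCoreFrame_of_oneSidedCongruenceDataLeAt₂ [W.IsElliptic]
    (h : P2.OneSidedCongruenceDataLeAt₂ W p κ 𝔭L 𝔭X γ ι f) :
    ∃ (ΩK : ℂ) (Ωp : ℂ_[p]) (Q : PowerSeries 𝓞_ℂ_[p]), ΩK ≠ 0 ∧ ‖Ωp‖ = 1 ∧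
      R1.IsBDPLFunctionInt p ι 𝔭L κ γ f ΩK Ωp Q ∧
      (XAc.charIdeal (W.baseChange K) p κ 𝔭X ∅ γ).map (PowerSeries.map (R1.toCpInt p)) ≤
        Ideal.span {Q} := by
  obtain ⟨ΩK, Ωp, L, hΩ, hL, hdiv⟩ := P2.exists_unrFrame_charIdeal_map_le_of_oneSidedCongruenceDataLeAt₂ h
  exact P2.exists_intCoreFrame_of_unrFrame_of_charIdeal_map_le_twoSlot hΩ hL hdiv

end TwoPrimes

/-! ### §2 On the tree: the two-prime package at every erratum datum ⟹ the repaired crux's shape -/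

section OnTree

variable (W : WeierstrassCurve ℚ) [W.IsElliptic] [W.IsGloballyMinimal] (p : ℕ) [Fact p.Prime]

/-- **ONE-SIDED CONGRUENCE DATA AT EVERY ERRATUM DATUM, TWO PRIMES, X-SLOT `𝔭bar`** (orient-a1's wrapper, landed
verbatim; asserts nothing): the binders of `P2.OneSidedCongruenceDataLeAtErratumData` VERBATIM, then `𝔭bar ∋ p`,
`𝔭bar ≠ 𝔭_{ι'}`, and the package `P2.OneSidedCongruenceDataLeAt₂ W p κ 𝔭_{ι'} 𝔭bar γ ι' Dt.f` (frame at the datum's prime,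
every Selmer-dual conjunct at `𝔭bar`). A predicate; NEVER a theorem in this cell.
[claim: Castella2018Erratum, status: under-review]
[cite: Castella2018Erratum, Thm. 1.1 and its proof (pp. 1, 4) (shape only; nothing asserted)]
[cite: FouquetWan2021, Thm. 4.41 (shape only; nothing asserted)] -/
@[conjecture]
def P2.OneSidedCongruenceDataLeAtErratumDataB : Prop :=
  ∀ [NeZero (W.conductorNorm ℤ)] (q : ℕ) [Fact q.Prime] (K : Type) [Field K] [NumberField K]
    (Dt : ModularParametrizationData W (W.conductorNorm ℤ))
    (H : HeegnerDatum (W.conductorNorm ℤ) (NumberField.discr K)) (w₀ : InfinitePlace K)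
    (P : (W.baseChange K).toAffine.Point), ErratumHypotheses W p → W.analyticRank = 1 →
    q ≠ p → Mult W q → ¬ W.HasSplitMultiplicativeReductionAtPrime q →
    ¬ p ∣ padicValInt q W.minimalDiscriminantInt → IsErratumField W K q →
    Cas20Standing K p (W.conductorNorm ℤ / p) →
    WeierstrassCurve.Affine.Point.map w₀.embedding.toRatAlgHom P = heegnerPointComplex Dt H →
    ¬ (p : ℤ) ∣ Dt.c → ¬ IsOfFinAddOrder P →
    ∀ (κ : ZpExtension K p), κ.IsAnticyclotomic →
      ∀ (γ : Field.absoluteGaloisGroup K) [Fact (κ.IsTopGenerator γ)] (ι' : PadicAlgCl p ≃+* ℂ)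
        (e : K →+* ℚ_[p]),
        (∀ k : 𝓞 K, k ∈ (primeOfEmbeddingDatum p ι' w₀.embedding).asIdeal ↔ ‖e (k : K)‖ < 1) →
        ∀ (𝔭bar : HeightOneSpectrum (𝓞 K)), ((p : ℕ) : 𝓞 K) ∈ 𝔭bar.asIdeal →
          𝔭bar ≠ primeOfEmbeddingDatum p ι' w₀.embedding →
          P2.OneSidedCongruenceDataLeAt₂ W p κ (primeOfEmbeddingDatum p ι' w₀.embedding) 𝔭bar γ ι' Dt.f

variable {W p}

/-- **THE GLUE, PACKAGE OF RECORD, TWO PRIMES: one-sided congruence data at every erratum datum with the frame at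
`𝔭_{ι'}` and the Selmer duals at `𝔭bar` ⟹ `P2.IMCDivIntCoreFrameAtErratumDataB W p`** (the repaired crux's shape).
CONDITIONAL on the package; closes nothing by itself. [cite: Castella2018Erratum, proof of Thm. 1.1 (p. 4), read one-sidedly]
[cite: Skinner2016PacificMC, §3.1 (p. 192)] -/
theorem P2.imcDivIntCoreFrameAtErratumDataB_of_oneSidedCongruenceDataLeAtErratumDataB
    (h : P2.OneSidedCongruenceDataLeAtErratumDataB W p) : P2.IMCDivIntCoreFrameAtErratumDataB W p := by
  intro _ q _ K _ _ Dt H w₀ P hE hr hqp hmq hns hvq hK hCas hP hc hinf κ hκ γ _ ι' e he 𝔭bar h𝔭bar hne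
  exact P2.exists_intCoreFrame_of_oneSidedCongruenceDataLeAt₂
    (h q K Dt H w₀ P hE hr hqp hmq hns hvq hK hCas hP hc hinf κ hκ γ ι' e he 𝔭bar h𝔭bar hne)

end OnTree

/-! ### §3 The two-prime package feeds the coefficient-free two-stub cut (`Σ`-data at `𝔭X`, two-slot frame) -/

section Feed

variable {K : Type} [Field K] [NumberField K] {W : WeierstrassCurve ℚ} [W.IsElliptic] {p : ℕ}
  [Fact p.Prime] {κ : ZpExtension K p} {𝔭L 𝔭X : HeightOneSpectrum (𝓞 K)} {γ : Field.absoluteGaloisGroup K}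
  [Fact (κ.IsTopGenerator γ)] {ι : PadicAlgCl p ≃+* ℂ} {N : ℕ}
  {f : CuspForm (CongruenceSubgroup.Gamma0 N) 2}

/-- **The two-prime package ⟹ `Σ`-data at the X-slot `𝔭X` AND the two-slot Fitting-level congruence frame at `(𝔭L, 𝔭X)`,
for the package's own `(Σ, P_Σ)`** — the `Λ`-members are members over the trivial coefficient square
`Λ → Λ →(map toUnr) R₀⟦T⟧ ← R₀⟦T⟧` (`R₀⟦T⟧` faithfully flat over itself), (2.5)_m printed over the Noetherian UFD `Λ`:
p490889's `P2.RoadFF.fittingCongruenceFrameAt_of_roadFF` at two slots, through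
`P2.RoadFF.fittingCongruenceFrameTwoSlotAt_of_members_descent_le_printed`. Unconditional in the package.
[cite: Castella2018Erratum, proof of Thm. 1.1 (p. 4), read one-sidedly] -/
theorem P2.RoadFF.exists_sigmaDataAt_fittingCongruenceFrameTwoSlotAt_of_oneSidedCongruenceDataLeAt₂
    (h : P2.OneSidedCongruenceDataLeAt₂ W p κ 𝔭L 𝔭X γ ι f) :
    ∃ (S : Set (HeightOneSpectrum (𝓞 K))) (PS : IwasawaAlgebra p),
      P2.RoadFF.SigmaDataAt W p κ 𝔭X γ S PS ∧
        P2.RoadFF.FittingCongruenceFrameTwoSlotAt W p κ 𝔭L 𝔭X γ ι f S PS := by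
  obtain ⟨ΩK, Ωp, L, S, PS, LS, Nm, Lm, hΩ, hL, hS, hT, hPS, hX, hLS, hfin, he, hF, hc⟩ := h
  haveI : ∀ m, Module.Finite (IwasawaAlgebra p) (Nm m) := hfin
  refine ⟨S, PS, ⟨hS, hT, hPS, hX⟩, ?_⟩
  refine P2.RoadFF.fittingCongruenceFrameTwoSlotAt_of_members_descent_le_printed hΩ hL LS hLS hS
    (fun _ ↦ IwasawaAlgebra p) (fun _ ↦ UnrSeries p) (fun _ ↦ PowerSeries.map (toUnr p))
    (fun _ ↦ by rw [Algebra.algebraMap_self, Algebra.algebraMap_self, RingHom.comp_id, RingHom.id_comp])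
    (fun m ↦ Nm m) (fun m ↦ Lm m)
    (fun m hm ↦ (CongruenceDescent.nonempty_quotEquiv_of_lid _ m (he m hm).some).some)
    (fun m hm hNt ↦ hF m hm hNt)
    (fun m hm ↦ ?_)
  rw [Algebra.algebraMap_self, RingHom.id_apply, Ideal.map_id, HidaLimitAlgebra.map_span_C_p]
  exact hc m hm

end Feed

end Summit.BirchSwinnertonDyer.Rank1Residual.X11b

end
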